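import Mathlib.Tactic
import HarnessLib

/-!
# The gluing inequality GC for THREE relays — the hair inequalities of two pendant three-port stars
# (`NoHeavyLowerTail` cell, stmt-CriticalPhenomena-4575; prover `prim-hp-2`, deletion–contraction line, gen 12)

Support file (`--supports stmt-CriticalPhenomena-4575`).  No definitions, no named facts, no sorries; pure real algebra.
Memo: `run/shared/lean/prim/prim-hp-2/MEMO-gen12-gc-three-relays.md` §2.  Companion: `…KNGoodGCThreeArith.lean` (the two
witness cases of GC₃ in closed form).

Two pendant relay-stars `x, y` with hair probabilities `x₁ x₂ x₃`, `y₁ y₂ y₃ ∈ [0,1]` towards three relays; `X_B = ∏_{a∈B} x_a ∏_{a∉B}(1−x_a)`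
is the law of the hit pattern of `x`, `α_x = X_∅ + X₁ + X₂ + X₃` the probability that `x` hits at most one port (glues nothing), and
`H_a = x_a + y_a − x_a y_a` the hair probabilities of the MERGED star.  A joint pattern of the two separate stars glues the core into
one of the worlds `d, [12], [13], [23], [123]`, with `q_d = α_x α_y`, `q₁₃ = X₁₃(α_y + Y₁₃) + Y₁₃ α_x`, `q₁₂ = X₁₂(α_y + Y₁₂) + Y₁₂ α_x`.

* `KNGoodGC3.hairIneq_middle` — **(HI2)** `(1 − H₃)·q₁₃ ≤ H₁H₃·q_d`;
* `KNGoodGC3.hairIneq_top` — **(HI3)** `(1 − H₁H₂)·q₁₂ ≤ H₁H₂·q_d`;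
* `KNGoodGC3.noHit23_le_qd` — `(1−H₂)(1−H₃) ≤ q_d`;  `KNGoodGC3.noHit3_le_qd_add_q12` — `1−H₃ ≤ q_d + q₁₂`
(the degeneracy bounds used when a world weight vanishes).  These are the only facts about the hair laws that the proof of
GC₃ needs (memo §2); everything is stated with `α_x, α_y` abbreviated by hypotheses `hαx, hαy`.
[cite: KozmaNitzan2024, §3.2 Definition and Thms. 4–5 (pp. 12–14) — the pattern law of a one-layer observer]
-/

namespace Summit.CriticalPhenomena.PercolationContinuityZ3.Theorems

namespace KNGoodGC3

/-! ### Pattern sums of one pendant three-port star -/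

/-- The probability that a three-port star hits at most one port, regrouped on the third port:
`α = (1−x₃)(1−x₁x₂) + x₃(1−x₁)(1−x₂)`. [folklore] -/
theorem alpha_eq (x₁ x₂ x₃ : ℝ) :
    (1 - x₁) * (1 - x₂) * (1 - x₃) + x₁ * (1 - x₂) * (1 - x₃) + (1 - x₁) * x₂ * (1 - x₃) + (1 - x₁) * (1 - x₂) * x₃ =
      (1 - x₃) * (1 - x₁ * x₂) + x₃ * (1 - x₁) * (1 - x₂) := by
  ring

/-- Merged hair probability `x + y − xy ∈ [0,1]` (lower bound). [folklore] -/
theorem merged_nonneg {x y : ℝ} (hx : 0 ≤ x) (hy : 0 ≤ y) (hy' : y ≤ 1) : 0 ≤ x + y - x * y := by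
  have h : 0 ≤ x * (1 - y) := mul_nonneg hx (by linarith)
  linarith

/-- Merged hair probability `x + y − xy ∈ [0,1]` (upper bound). [folklore] -/
theorem merged_le_one {x y : ℝ} (hx' : x ≤ 1) (hy' : y ≤ 1) : x + y - x * y ≤ 1 := by
  have h : 0 ≤ (1 - x) * (1 - y) := mul_nonneg (by linarith) (by linarith)
  linarith

/-- The at-most-one-port probability `α` is nonnegative. [folklore] -/
theorem alpha_nonneg {x₁ x₂ x₃ : ℝ} (h₁ : 0 ≤ x₁) (h₁' : x₁ ≤ 1) (h₂ : 0 ≤ x₂) (h₂' : x₂ ≤ 1) (h₃ : 0 ≤ x₃) (h₃' : x₃ ≤ 1) :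
    0 ≤ (1 - x₁) * (1 - x₂) * (1 - x₃) + x₁ * (1 - x₂) * (1 - x₃) + (1 - x₁) * x₂ * (1 - x₃) + (1 - x₁) * (1 - x₂) * x₃ := by
  have t1 : 0 ≤ (1 - x₁) * (1 - x₂) * (1 - x₃) := mul_nonneg (mul_nonneg (by linarith) (by linarith)) (by linarith)
  have t2 : 0 ≤ x₁ * (1 - x₂) * (1 - x₃) := mul_nonneg (mul_nonneg h₁ (by linarith)) (by linarith)
  have t3 : 0 ≤ (1 - x₁) * x₂ * (1 - x₃) := mul_nonneg (mul_nonneg (by linarith) h₂) (by linarith)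
  have t4 : 0 ≤ (1 - x₁) * (1 - x₂) * x₃ := mul_nonneg (mul_nonneg (by linarith) (by linarith)) h₃
  linarith

/-- `α ≥ (1−x₂)(1−x₃)` (the patterns `∅` and `{1}`). [folklore] -/
theorem noHit_le_alpha {x₁ x₂ x₃ : ℝ} (_h₁ : 0 ≤ x₁) (h₁' : x₁ ≤ 1) (h₂ : 0 ≤ x₂) (h₂' : x₂ ≤ 1) (h₃ : 0 ≤ x₃) (h₃' : x₃ ≤ 1) :
    (1 - x₂) * (1 - x₃) ≤
      (1 - x₁) * (1 - x₂) * (1 - x₃) + x₁ * (1 - x₂) * (1 - x₃) + (1 - x₁) * x₂ * (1 - x₃) + (1 - x₁) * (1 - x₂) * x₃ := by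
  have e : (1 - x₁) * (1 - x₂) * (1 - x₃) + x₁ * (1 - x₂) * (1 - x₃) + (1 - x₁) * x₂ * (1 - x₃) + (1 - x₁) * (1 - x₂) * x₃ -
      (1 - x₂) * (1 - x₃) = (1 - x₃) * (1 - x₁) * x₂ + (1 - x₁) * (1 - x₂) * x₃ := by ring
  have p1 : 0 ≤ (1 - x₃) * (1 - x₁) * x₂ := mul_nonneg (mul_nonneg (by linarith) (by linarith)) h₂
  have p2 : 0 ≤ (1 - x₁) * (1 - x₂) * x₃ := mul_nonneg (mul_nonneg (by linarith) (by linarith)) h₃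
  linarith

/-- `α ≥ (1−x₃)(1−x₁x₂)` (no hair at the third port). [folklore] -/
theorem noHit3_le_alpha {x₁ x₂ x₃ : ℝ} (_h₁ : 0 ≤ x₁) (h₁' : x₁ ≤ 1) (_h₂ : 0 ≤ x₂) (h₂' : x₂ ≤ 1) (h₃ : 0 ≤ x₃) (_h₃' : x₃ ≤ 1) :
    (1 - x₃) * (1 - x₁ * x₂) ≤
      (1 - x₁) * (1 - x₂) * (1 - x₃) + x₁ * (1 - x₂) * (1 - x₃) + (1 - x₁) * x₂ * (1 - x₃) + (1 - x₁) * (1 - x₂) * x₃ := by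
  rw [alpha_eq]
  have p : 0 ≤ x₃ * (1 - x₁) * (1 - x₂) := mul_nonneg (mul_nonneg h₃ (by linarith)) (by linarith)
  linarith

/-- Swallowing the pattern `{1,3}`: `(1−y₃)(α_y + y₁(1−y₂)y₃) ≤ α_y`. [folklore] -/
theorem absorb13_le_alpha {y₁ y₂ y₃ : ℝ} (_h₁ : 0 ≤ y₁) (h₁' : y₁ ≤ 1) (h₂ : 0 ≤ y₂) (h₂' : y₂ ≤ 1) (h₃ : 0 ≤ y₃) (h₃' : y₃ ≤ 1) :
    (1 - y₃) * (((1 - y₁) * (1 - y₂) * (1 - y₃) + y₁ * (1 - y₂) * (1 - y₃) + (1 - y₁) * y₂ * (1 - y₃) + (1 - y₁) * (1 - y₂) * y₃) +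
        y₁ * (1 - y₂) * y₃) ≤
      (1 - y₁) * (1 - y₂) * (1 - y₃) + y₁ * (1 - y₂) * (1 - y₃) + (1 - y₁) * y₂ * (1 - y₃) + (1 - y₁) * (1 - y₂) * y₃ := by
  have e : ((1 - y₁) * (1 - y₂) * (1 - y₃) + y₁ * (1 - y₂) * (1 - y₃) + (1 - y₁) * y₂ * (1 - y₃) + (1 - y₁) * (1 - y₂) * y₃) -
      (1 - y₃) * (((1 - y₁) * (1 - y₂) * (1 - y₃) + y₁ * (1 - y₂) * (1 - y₃) + (1 - y₁) * y₂ * (1 - y₃) + (1 - y₁) * (1 - y₂) * y₃) +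
        y₁ * (1 - y₂) * y₃) =
      y₃ * ((1 - y₁) * (1 - y₂) * (1 - y₃) + (1 - y₁) * y₂ * (1 - y₃) + (1 - y₁) * (1 - y₂) * y₃) := by ring
  have p1 : 0 ≤ (1 - y₁) * (1 - y₂) * (1 - y₃) := mul_nonneg (mul_nonneg (by linarith) (by linarith)) (by linarith)
  have p2 : 0 ≤ (1 - y₁) * y₂ * (1 - y₃) := mul_nonneg (mul_nonneg (by linarith) h₂) (by linarith)
  have p3 : 0 ≤ (1 - y₁) * (1 - y₂) * y₃ := mul_nonneg (mul_nonneg (by linarith) (by linarith)) h₃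
  have p4 : 0 ≤ y₃ * ((1 - y₁) * (1 - y₂) * (1 - y₃) + (1 - y₁) * y₂ * (1 - y₃) + (1 - y₁) * (1 - y₂) * y₃) :=
    mul_nonneg h₃ (by linarith)
  linarith

/-- Swallowing the pattern `{1,2}`: `(1−y₁y₂)(α_y + y₁y₂(1−y₃)) ≤ α_y`. [folklore] -/
theorem absorb12_le_alpha {y₁ y₂ y₃ : ℝ} (h₁ : 0 ≤ y₁) (h₁' : y₁ ≤ 1) (h₂ : 0 ≤ y₂) (h₂' : y₂ ≤ 1) (h₃ : 0 ≤ y₃) (_h₃' : y₃ ≤ 1) :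
    (1 - y₁ * y₂) * (((1 - y₁) * (1 - y₂) * (1 - y₃) + y₁ * (1 - y₂) * (1 - y₃) + (1 - y₁) * y₂ * (1 - y₃) + (1 - y₁) * (1 - y₂) * y₃) +
        y₁ * y₂ * (1 - y₃)) ≤
      (1 - y₁) * (1 - y₂) * (1 - y₃) + y₁ * (1 - y₂) * (1 - y₃) + (1 - y₁) * y₂ * (1 - y₃) + (1 - y₁) * (1 - y₂) * y₃ := by
  have e : ((1 - y₁) * (1 - y₂) * (1 - y₃) + y₁ * (1 - y₂) * (1 - y₃) + (1 - y₁) * y₂ * (1 - y₃) + (1 - y₁) * (1 - y₂) * y₃) -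
      (1 - y₁ * y₂) * (((1 - y₁) * (1 - y₂) * (1 - y₃) + y₁ * (1 - y₂) * (1 - y₃) + (1 - y₁) * y₂ * (1 - y₃) + (1 - y₁) * (1 - y₂) * y₃) +
        y₁ * y₂ * (1 - y₃)) = y₁ * y₂ * (y₃ * (1 - y₁) * (1 - y₂)) := by ring
  have p : 0 ≤ y₁ * y₂ * (y₃ * (1 - y₁) * (1 - y₂)) :=
    mul_nonneg (mul_nonneg h₁ h₂) (mul_nonneg (mul_nonneg h₃ (by linarith)) (by linarith))
  linarith

/-- The merged star dominates the separate double hits: `x₁x₃ + y₁y₃(1−x₁x₃) ≤ H₁H₃`, `H_a = x_a + y_a − x_a y_a`. [folklore] -/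
theorem doubleHit_le_merged {x₁ x₃ y₁ y₃ : ℝ} (hx₁ : 0 ≤ x₁) (hx₁' : x₁ ≤ 1) (hx₃ : 0 ≤ x₃) (hx₃' : x₃ ≤ 1)
    (hy₁ : 0 ≤ y₁) (hy₁' : y₁ ≤ 1) (hy₃ : 0 ≤ y₃) (hy₃' : y₃ ≤ 1) :
    x₁ * x₃ + y₁ * y₃ * (1 - x₁ * x₃) ≤ (x₁ + y₁ - x₁ * y₁) * (x₃ + y₃ - x₃ * y₃) := by
  have e : (x₁ + y₁ - x₁ * y₁) * (x₃ + y₃ - x₃ * y₃) - (x₁ * x₃ + y₁ * y₃ * (1 - x₁ * x₃)) =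
      x₁ * (1 - x₃) * (1 - y₁) * y₃ + (1 - x₁) * x₃ * y₁ * (1 - y₃) := by ring
  have p1 : 0 ≤ x₁ * (1 - x₃) * (1 - y₁) * y₃ := mul_nonneg (mul_nonneg (mul_nonneg hx₁ (by linarith)) (by linarith)) hy₃
  have p2 : 0 ≤ (1 - x₁) * x₃ * y₁ * (1 - y₃) := mul_nonneg (mul_nonneg (mul_nonneg (by linarith) hx₃) hy₁) (by linarith)
  linarith

/-! ### The two hair inequalities -/

/-- **Hair inequality (HI2)** for the case "the `K`-loneliest relay is the middle relay of the core":
`(1 − H₃)·q₁₃ ≤ H₁H₃·q_d`, where `q_d = α_x α_y` is the probability that the two separate stars glue nothing and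
`q₁₃ = X₁₃(α_y + Y₁₃) + Y₁₃ α_x` the probability that they glue exactly the pair `{1,3}`.  Proof (memo §2): split `q₁₃` by the star
that realises the pair; `(1−x₃)(1−y₃)X₁₃(α_y+Y₁₃) ≤ x₁x₃α_xα_y` (`noHit_le_alpha`, `absorb13_le_alpha`) and
`(1−x₃)(1−y₃)Y₁₃α_x ≤ y₁y₃(1−x₁x₃)α_xα_y`; then `doubleHit_le_merged`. [folklore] -/
theorem hairIneq_middle {x₁ x₂ x₃ y₁ y₂ y₃ αx αy : ℝ}
    (hx₁ : 0 ≤ x₁) (hx₁' : x₁ ≤ 1) (hx₂ : 0 ≤ x₂) (hx₂' : x₂ ≤ 1) (hx₃ : 0 ≤ x₃) (hx₃' : x₃ ≤ 1)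
    (hy₁ : 0 ≤ y₁) (hy₁' : y₁ ≤ 1) (hy₂ : 0 ≤ y₂) (hy₂' : y₂ ≤ 1) (hy₃ : 0 ≤ y₃) (hy₃' : y₃ ≤ 1)
    (hαx : αx = (1 - x₁) * (1 - x₂) * (1 - x₃) + x₁ * (1 - x₂) * (1 - x₃) + (1 - x₁) * x₂ * (1 - x₃) + (1 - x₁) * (1 - x₂) * x₃)
    (hαy : αy = (1 - y₁) * (1 - y₂) * (1 - y₃) + y₁ * (1 - y₂) * (1 - y₃) + (1 - y₁) * y₂ * (1 - y₃) + (1 - y₁) * (1 - y₂) * y₃) :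
    (1 - (x₃ + y₃ - x₃ * y₃)) * (x₁ * (1 - x₂) * x₃ * (αy + y₁ * (1 - y₂) * y₃) + y₁ * (1 - y₂) * y₃ * αx) ≤
      (x₁ + y₁ - x₁ * y₁) * (x₃ + y₃ - x₃ * y₃) * (αx * αy) := by
  have hαx0 : 0 ≤ αx := by rw [hαx]; exact alpha_nonneg hx₁ hx₁' hx₂ hx₂' hx₃ hx₃'
  have hαy0 : 0 ≤ αy := by rw [hαy]; exact alpha_nonneg hy₁ hy₁' hy₂ hy₂' hy₃ hy₃'
  -- (a) the `x`-star glues `{1,3}`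
  have hA : (1 - x₂) * (1 - x₃) ≤ αx := by rw [hαx]; exact noHit_le_alpha hx₁ hx₁' hx₂ hx₂' hx₃ hx₃'
  have hB : (1 - y₃) * (αy + y₁ * (1 - y₂) * y₃) ≤ αy := by rw [hαy]; exact absorb13_le_alpha hy₁ hy₁' hy₂ hy₂' hy₃ hy₃'
  have hB0 : 0 ≤ (1 - y₃) * (αy + y₁ * (1 - y₂) * y₃) :=
    mul_nonneg (by linarith) (add_nonneg hαy0 (mul_nonneg (mul_nonneg hy₁ (by linarith)) hy₃))
  have hprodA : (1 - x₂) * (1 - x₃) * ((1 - y₃) * (αy + y₁ * (1 - y₂) * y₃)) ≤ αx * αy :=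
    mul_le_mul hA hB hB0 hαx0
  have hx13 : 0 ≤ x₁ * x₃ := mul_nonneg hx₁ hx₃
  have partA : (1 - x₃) * (1 - y₃) * (x₁ * (1 - x₂) * x₃ * (αy + y₁ * (1 - y₂) * y₃)) ≤ x₁ * x₃ * (αx * αy) := by
    have e : (1 - x₃) * (1 - y₃) * (x₁ * (1 - x₂) * x₃ * (αy + y₁ * (1 - y₂) * y₃)) =
        x₁ * x₃ * ((1 - x₂) * (1 - x₃) * ((1 - y₃) * (αy + y₁ * (1 - y₂) * y₃))) := by ring
    rw [e]
    exact mul_le_mul_of_nonneg_left hprodA hx13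
  -- (b) the `y`-star glues `{1,3}`
  have hC : (1 - x₃) ≤ 1 - x₁ * x₃ := by linarith [mul_le_of_le_one_left hx₃ hx₁']
  have hD : (1 - y₂) * (1 - y₃) ≤ αy := by rw [hαy]; exact noHit_le_alpha hy₁ hy₁' hy₂ hy₂' hy₃ hy₃'
  have hprodB : (1 - x₃) * ((1 - y₂) * (1 - y₃)) ≤ (1 - x₁ * x₃) * αy :=
    mul_le_mul hC hD (mul_nonneg (by linarith) (by linarith)) (sub_nonneg.2 (mul_le_one₀ hx₁' hx₃ hx₃'))
  have hy13 : 0 ≤ y₁ * y₃ * αx := mul_nonneg (mul_nonneg hy₁ hy₃) hαx0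
  have partB : (1 - x₃) * (1 - y₃) * (y₁ * (1 - y₂) * y₃ * αx) ≤ y₁ * y₃ * (1 - x₁ * x₃) * (αx * αy) := by
    have e1 : (1 - x₃) * (1 - y₃) * (y₁ * (1 - y₂) * y₃ * αx) = y₁ * y₃ * αx * ((1 - x₃) * ((1 - y₂) * (1 - y₃))) := by ring
    have e2 : y₁ * y₃ * (1 - x₁ * x₃) * (αx * αy) = y₁ * y₃ * αx * ((1 - x₁ * x₃) * αy) := by ring
    rw [e1, e2]
    exact mul_le_mul_of_nonneg_left hprodB hy13
  -- (c) combine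
  have hM := doubleHit_le_merged hx₁ hx₁' hx₃ hx₃' hy₁ hy₁' hy₃ hy₃'
  have hαα : 0 ≤ αx * αy := mul_nonneg hαx0 hαy0
  have hM' : (x₁ * x₃ + y₁ * y₃ * (1 - x₁ * x₃)) * (αx * αy) ≤ (x₁ + y₁ - x₁ * y₁) * (x₃ + y₃ - x₃ * y₃) * (αx * αy) :=
    mul_le_mul_of_nonneg_right hM hαα
  have e : (1 - (x₃ + y₃ - x₃ * y₃)) * (x₁ * (1 - x₂) * x₃ * (αy + y₁ * (1 - y₂) * y₃) + y₁ * (1 - y₂) * y₃ * αx) =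
      (1 - x₃) * (1 - y₃) * (x₁ * (1 - x₂) * x₃ * (αy + y₁ * (1 - y₂) * y₃)) +
        (1 - x₃) * (1 - y₃) * (y₁ * (1 - y₂) * y₃ * αx) := by ring
  rw [e]
  linarith [partA, partB, hM']

/-- **Hair inequality (HI3)** for the case "the `K`-loneliest relay is the most reliable relay of the core":
`(1 − H₁H₂)·q₁₂ ≤ H₁H₂·q_d` with `q₁₂ = X₁₂(α_y + Y₁₂) + Y₁₂ α_x`.  Proof (memo §2): `1 − H₁H₂ ≤ (1−x₁x₂)(1−y₁y₂)`
(`doubleHit_le_merged`), `(1−x₁x₂)X₁₂ ≤ x₁x₂α_x` (`noHit3_le_alpha`), `(1−y₁y₂)(α_y+Y₁₂) ≤ α_y` (`absorb12_le_alpha`),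
`(1−y₁y₂)Y₁₂ ≤ y₁y₂α_y`. [folklore] -/
theorem hairIneq_top {x₁ x₂ x₃ y₁ y₂ y₃ αx αy : ℝ}
    (hx₁ : 0 ≤ x₁) (hx₁' : x₁ ≤ 1) (hx₂ : 0 ≤ x₂) (hx₂' : x₂ ≤ 1) (hx₃ : 0 ≤ x₃) (hx₃' : x₃ ≤ 1)
    (hy₁ : 0 ≤ y₁) (hy₁' : y₁ ≤ 1) (hy₂ : 0 ≤ y₂) (hy₂' : y₂ ≤ 1) (hy₃ : 0 ≤ y₃) (hy₃' : y₃ ≤ 1)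
    (hαx : αx = (1 - x₁) * (1 - x₂) * (1 - x₃) + x₁ * (1 - x₂) * (1 - x₃) + (1 - x₁) * x₂ * (1 - x₃) + (1 - x₁) * (1 - x₂) * x₃)
    (hαy : αy = (1 - y₁) * (1 - y₂) * (1 - y₃) + y₁ * (1 - y₂) * (1 - y₃) + (1 - y₁) * y₂ * (1 - y₃) + (1 - y₁) * (1 - y₂) * y₃) :
    (1 - (x₁ + y₁ - x₁ * y₁) * (x₂ + y₂ - x₂ * y₂)) * (x₁ * x₂ * (1 - x₃) * (αy + y₁ * y₂ * (1 - y₃)) + y₁ * y₂ * (1 - y₃) * αx) ≤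
      (x₁ + y₁ - x₁ * y₁) * (x₂ + y₂ - x₂ * y₂) * (αx * αy) := by
  have hαx0 : 0 ≤ αx := by rw [hαx]; exact alpha_nonneg hx₁ hx₁' hx₂ hx₂' hx₃ hx₃'
  have hαy0 : 0 ≤ αy := by rw [hαy]; exact alpha_nonneg hy₁ hy₁' hy₂ hy₂' hy₃ hy₃'
  have hαα : 0 ≤ αx * αy := mul_nonneg hαx0 hαy0
  set q : ℝ := x₁ * x₂ * (1 - x₃) * (αy + y₁ * y₂ * (1 - y₃)) + y₁ * y₂ * (1 - y₃) * αx with hq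
  have hq0 : 0 ≤ q := by
    rw [hq]
    have t1 : 0 ≤ x₁ * x₂ * (1 - x₃) * (αy + y₁ * y₂ * (1 - y₃)) :=
      mul_nonneg (mul_nonneg (mul_nonneg hx₁ hx₂) (by linarith)) (add_nonneg hαy0 (mul_nonneg (mul_nonneg hy₁ hy₂) (by linarith)))
    have t2 : 0 ≤ y₁ * y₂ * (1 - y₃) * αx := mul_nonneg (mul_nonneg (mul_nonneg hy₁ hy₂) (by linarith)) hαx0
    linarith
  -- step 0: `1 − H₁H₂ ≤ (1−x₁x₂)(1−y₁y₂)`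
  have hM := doubleHit_le_merged hx₁ hx₁' hx₂ hx₂' hy₁ hy₁' hy₂ hy₂'
  have step0 : (1 - (x₁ + y₁ - x₁ * y₁) * (x₂ + y₂ - x₂ * y₂)) * q ≤ (1 - x₁ * x₂) * (1 - y₁ * y₂) * q := by
    apply mul_le_mul_of_nonneg_right _ hq0
    have e : (1 - x₁ * x₂) * (1 - y₁ * y₂) = 1 - (x₁ * x₂ + y₁ * y₂ * (1 - x₁ * x₂)) := by ring
    rw [e]; linarith
  -- step 1: `(1−x₁x₂)X₁₂ ≤ x₁x₂ α_x`
  have hA : (1 - x₃) * (1 - x₁ * x₂) ≤ αx := by rw [hαx]; exact noHit3_le_alpha hx₁ hx₁' hx₂ hx₂' hx₃ hx₃'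
  have hx12 : 0 ≤ x₁ * x₂ := mul_nonneg hx₁ hx₂
  have step1 : (1 - x₁ * x₂) * (x₁ * x₂ * (1 - x₃)) ≤ x₁ * x₂ * αx := by
    have e : (1 - x₁ * x₂) * (x₁ * x₂ * (1 - x₃)) = x₁ * x₂ * ((1 - x₃) * (1 - x₁ * x₂)) := by ring
    rw [e]; exact mul_le_mul_of_nonneg_left hA hx12
  -- step 2: `(1−y₁y₂)(α_y + Y₁₂) ≤ α_y`
  have step2 : (1 - y₁ * y₂) * (αy + y₁ * y₂ * (1 - y₃)) ≤ αy := by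
    rw [hαy]; exact absorb12_le_alpha hy₁ hy₁' hy₂ hy₂' hy₃ hy₃'
  have step2nn : 0 ≤ (1 - y₁ * y₂) * (αy + y₁ * y₂ * (1 - y₃)) :=
    mul_nonneg (sub_nonneg.2 (mul_le_one₀ hy₁' hy₂ hy₂')) (add_nonneg hαy0 (mul_nonneg (mul_nonneg hy₁ hy₂) (by linarith)))
  -- step 3: part (a)
  have partA : (1 - x₁ * x₂) * (1 - y₁ * y₂) * (x₁ * x₂ * (1 - x₃) * (αy + y₁ * y₂ * (1 - y₃))) ≤ x₁ * x₂ * (αx * αy) := by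
    have e : (1 - x₁ * x₂) * (1 - y₁ * y₂) * (x₁ * x₂ * (1 - x₃) * (αy + y₁ * y₂ * (1 - y₃))) =
        ((1 - x₁ * x₂) * (x₁ * x₂ * (1 - x₃))) * ((1 - y₁ * y₂) * (αy + y₁ * y₂ * (1 - y₃))) := by ring
    have e2 : x₁ * x₂ * (αx * αy) = (x₁ * x₂ * αx) * αy := by ring
    rw [e, e2]
    exact mul_le_mul step1 step2 step2nn (mul_nonneg hx12 hαx0)
  -- step 4: part (b): `(1−y₁y₂)Y₁₂ ≤ y₁y₂ α_y`
  have hBy : (1 - y₃) * (1 - y₁ * y₂) ≤ αy := by rw [hαy]; exact noHit3_le_alpha hy₁ hy₁' hy₂ hy₂' hy₃ hy₃'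
  have hy12 : 0 ≤ y₁ * y₂ := mul_nonneg hy₁ hy₂
  have step4 : (1 - y₁ * y₂) * (y₁ * y₂ * (1 - y₃)) ≤ y₁ * y₂ * αy := by
    have e : (1 - y₁ * y₂) * (y₁ * y₂ * (1 - y₃)) = y₁ * y₂ * ((1 - y₃) * (1 - y₁ * y₂)) := by ring
    rw [e]; exact mul_le_mul_of_nonneg_left hBy hy12
  have h1x : 0 ≤ (1 - x₁ * x₂) * αx := mul_nonneg (sub_nonneg.2 (mul_le_one₀ hx₁' hx₂ hx₂')) hαx0
  have partB : (1 - x₁ * x₂) * (1 - y₁ * y₂) * (y₁ * y₂ * (1 - y₃) * αx) ≤ y₁ * y₂ * (1 - x₁ * x₂) * (αx * αy) := by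
    have e1 : (1 - x₁ * x₂) * (1 - y₁ * y₂) * (y₁ * y₂ * (1 - y₃) * αx) = ((1 - x₁ * x₂) * αx) * ((1 - y₁ * y₂) * (y₁ * y₂ * (1 - y₃))) := by
      ring
    have e2 : y₁ * y₂ * (1 - x₁ * x₂) * (αx * αy) = ((1 - x₁ * x₂) * αx) * (y₁ * y₂ * αy) := by ring
    rw [e1, e2]
    exact mul_le_mul_of_nonneg_left step4 h1x
  -- step 5: combine
  have hM' : (x₁ * x₂ + y₁ * y₂ * (1 - x₁ * x₂)) * (αx * αy) ≤ (x₁ + y₁ - x₁ * y₁) * (x₂ + y₂ - x₂ * y₂) * (αx * αy) :=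
    mul_le_mul_of_nonneg_right hM hαα
  have e : (1 - x₁ * x₂) * (1 - y₁ * y₂) * q =
      (1 - x₁ * x₂) * (1 - y₁ * y₂) * (x₁ * x₂ * (1 - x₃) * (αy + y₁ * y₂ * (1 - y₃))) +
        (1 - x₁ * x₂) * (1 - y₁ * y₂) * (y₁ * y₂ * (1 - y₃) * αx) := by rw [hq]; ring
  have key : (1 - x₁ * x₂) * (1 - y₁ * y₂) * q ≤ (x₁ * x₂ + y₁ * y₂ * (1 - x₁ * x₂)) * (αx * αy) := by
    rw [e]; linarith [partA, partB]
  linarith [step0, key, hM']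

/-! ### Degeneracy bounds: the no-gluing world is at least as likely as "no hair outside one port" -/

/-- `(1−H₂)(1−H₃) ≤ q_d`: if neither star touches the ports `2, 3` then nothing is glued. [folklore] -/
theorem noHit23_le_qd {x₁ x₂ x₃ y₁ y₂ y₃ αx αy : ℝ}
    (hx₁ : 0 ≤ x₁) (hx₁' : x₁ ≤ 1) (hx₂ : 0 ≤ x₂) (hx₂' : x₂ ≤ 1) (hx₃ : 0 ≤ x₃) (hx₃' : x₃ ≤ 1)
    (hy₁ : 0 ≤ y₁) (hy₁' : y₁ ≤ 1) (hy₂ : 0 ≤ y₂) (hy₂' : y₂ ≤ 1) (hy₃ : 0 ≤ y₃) (hy₃' : y₃ ≤ 1)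
    (hαx : αx = (1 - x₁) * (1 - x₂) * (1 - x₃) + x₁ * (1 - x₂) * (1 - x₃) + (1 - x₁) * x₂ * (1 - x₃) + (1 - x₁) * (1 - x₂) * x₃)
    (hαy : αy = (1 - y₁) * (1 - y₂) * (1 - y₃) + y₁ * (1 - y₂) * (1 - y₃) + (1 - y₁) * y₂ * (1 - y₃) + (1 - y₁) * (1 - y₂) * y₃) :
    (1 - (x₂ + y₂ - x₂ * y₂)) * (1 - (x₃ + y₃ - x₃ * y₃)) ≤ αx * αy := by
  have hA : (1 - x₂) * (1 - x₃) ≤ αx := by rw [hαx]; exact noHit_le_alpha hx₁ hx₁' hx₂ hx₂' hx₃ hx₃'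
  have hB : (1 - y₂) * (1 - y₃) ≤ αy := by rw [hαy]; exact noHit_le_alpha hy₁ hy₁' hy₂ hy₂' hy₃ hy₃'
  have e : (1 - (x₂ + y₂ - x₂ * y₂)) * (1 - (x₃ + y₃ - x₃ * y₃)) = ((1 - x₂) * (1 - x₃)) * ((1 - y₂) * (1 - y₃)) := by ring
  rw [e]
  exact mul_le_mul hA hB (mul_nonneg (by linarith) (by linarith)) (by rw [hαx]; exact alpha_nonneg hx₁ hx₁' hx₂ hx₂' hx₃ hx₃')

/-- `1 − H₃ ≤ q_d + q₁₂`: if neither star touches port `3` the world is `d` or `[12]`. [folklore] -/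
theorem noHit3_le_qd_add_q12 {x₁ x₂ x₃ y₁ y₂ y₃ αx αy : ℝ}
    (hx₁ : 0 ≤ x₁) (hx₁' : x₁ ≤ 1) (hx₂ : 0 ≤ x₂) (hx₂' : x₂ ≤ 1) (hx₃ : 0 ≤ x₃) (hx₃' : x₃ ≤ 1)
    (hy₁ : 0 ≤ y₁) (hy₁' : y₁ ≤ 1) (hy₂ : 0 ≤ y₂) (hy₂' : y₂ ≤ 1) (hy₃ : 0 ≤ y₃) (hy₃' : y₃ ≤ 1)
    (hαx : αx = (1 - x₁) * (1 - x₂) * (1 - x₃) + x₁ * (1 - x₂) * (1 - x₃) + (1 - x₁) * x₂ * (1 - x₃) + (1 - x₁) * (1 - x₂) * x₃)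
    (hαy : αy = (1 - y₁) * (1 - y₂) * (1 - y₃) + y₁ * (1 - y₂) * (1 - y₃) + (1 - y₁) * y₂ * (1 - y₃) + (1 - y₁) * (1 - y₂) * y₃) :
    (1 - (x₃ + y₃ - x₃ * y₃)) ≤ αx * αy + (x₁ * x₂ * (1 - x₃) * (αy + y₁ * y₂ * (1 - y₃)) + y₁ * y₂ * (1 - y₃) * αx) := by
  -- `(1−x₃)(1−y₃) = (α'_x + X₁₂)(α'_y + Y₁₂)` with `α' = α − X₃ ≤ α`
  have ex : 1 - x₃ = ((1 - x₁) * (1 - x₂) * (1 - x₃) + x₁ * (1 - x₂) * (1 - x₃) + (1 - x₁) * x₂ * (1 - x₃)) + x₁ * x₂ * (1 - x₃) := by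
    ring
  have ey : 1 - y₃ = ((1 - y₁) * (1 - y₂) * (1 - y₃) + y₁ * (1 - y₂) * (1 - y₃) + (1 - y₁) * y₂ * (1 - y₃)) + y₁ * y₂ * (1 - y₃) := by
    ring
  have hX3 : 0 ≤ (1 - x₁) * (1 - x₂) * x₃ := mul_nonneg (mul_nonneg (by linarith) (by linarith)) hx₃
  have hY3 : 0 ≤ (1 - y₁) * (1 - y₂) * y₃ := mul_nonneg (mul_nonneg (by linarith) (by linarith)) hy₃
  have hax' : 0 ≤ (1 - x₁) * (1 - x₂) * (1 - x₃) + x₁ * (1 - x₂) * (1 - x₃) + (1 - x₁) * x₂ * (1 - x₃) := by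
    have t1 : 0 ≤ (1 - x₁) * (1 - x₂) * (1 - x₃) := mul_nonneg (mul_nonneg (by linarith) (by linarith)) (by linarith)
    have t2 : 0 ≤ x₁ * (1 - x₂) * (1 - x₃) := mul_nonneg (mul_nonneg hx₁ (by linarith)) (by linarith)
    have t3 : 0 ≤ (1 - x₁) * x₂ * (1 - x₃) := mul_nonneg (mul_nonneg (by linarith) hx₂) (by linarith)
    linarith
  have hay' : 0 ≤ (1 - y₁) * (1 - y₂) * (1 - y₃) + y₁ * (1 - y₂) * (1 - y₃) + (1 - y₁) * y₂ * (1 - y₃) := by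
    have t1 : 0 ≤ (1 - y₁) * (1 - y₂) * (1 - y₃) := mul_nonneg (mul_nonneg (by linarith) (by linarith)) (by linarith)
    have t2 : 0 ≤ y₁ * (1 - y₂) * (1 - y₃) := mul_nonneg (mul_nonneg hy₁ (by linarith)) (by linarith)
    have t3 : 0 ≤ (1 - y₁) * y₂ * (1 - y₃) := mul_nonneg (mul_nonneg (by linarith) hy₂) (by linarith)
    linarith
  have hX12 : 0 ≤ x₁ * x₂ * (1 - x₃) := mul_nonneg (mul_nonneg hx₁ hx₂) (by linarith)
  have hY12 : 0 ≤ y₁ * y₂ * (1 - y₃) := mul_nonneg (mul_nonneg hy₁ hy₂) (by linarith)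
  have e : (1 - (x₃ + y₃ - x₃ * y₃)) = (1 - x₃) * (1 - y₃) := by ring
  rw [e, ex, ey, hαx, hαy]
  nlinarith [mul_nonneg hax' hay', mul_nonneg hax' hY12, mul_nonneg hX12 hay', mul_nonneg hX12 hY12, mul_nonneg hX3 hay',
    mul_nonneg hax' hY3, mul_nonneg hX3 hY3, mul_nonneg hX3 hY12, mul_nonneg hX12 hY3]

end KNGoodGC3

end Summit.CriticalPhenomena.PercolationContinuityZ3.Theorems
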